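import Mathlib
import Summits.Ventures.PercRepro2.TypedBHKHalf

/-!
# Typed BHK 1.4 (row 2′TB) is a THEOREM when the root `a₁` is a pendant vertex
(blind cell PercRepro2, p5 g2, 2026-08-25; sub-claim S4, `proofs/P5-TB14.md` §1)

`TB14` (candidate of record) asserts `N(Q ∩ A ∩ B, Q) ≤ N(Q ∩ A, Q ∩ B)` at every profile, for
`Q = {a₁ ↮ a₂}`, `A = {b ∈ C(a₁)}`, `B = {o ∈ C(a₂)}` (`A3InactiveTyped.sameBO` / `crossBO`).
When `a₁` has exactly one incident edge `f` and `f` is free, the second copy's `Q` is vacuous on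
every configuration that contributes (if `f` is red, `a₁` is isolated in the second copy; if `f`
is blue, `b ∉ C(a₁)` and nothing contributes), so the inequality IS the half-conditioned form
`TypedBHKHalf.pairCount_half`:

  `tb14_of_pendant_root : pairCount F z (sameBO …) ≤ pairCount F z (crossBO …)`

for every such instance (hypotheses: every edge at `a₁` is `f`, `f ∈ F`, `b ≠ a₁`, `a₂ ≠ a₁`).
Unconditional, standard axioms; with mine-c's `tb14_of_sep` / `tb14_of_leaf` a kernel rung of
row 2′TB.
-/

namespace Summit.Ventures.PercRepro2

namespace TypedBHKHalf

open CovForm A3InactiveTyped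

section Pendant

variable {V : Type} {E : Type} {R : Type*} [Field R]

/-- If every edge at `a₁` is `f` and `f` is closed in `ω`, then `a₁` is connected to nothing else. -/
lemma not_conn_of_pendant_closed (ends : E → Sym2 V) (a₁ : V) (f : E)
    (hpend : ∀ e, a₁ ∈ ends e → e = f) {ω : Config E} (hf : ω f = false) {v : V} (hv : v ≠ a₁) :
    ¬ Conn ends ω a₁ v := by
  intro h
  have key : v ∈ {u | u = a₁} := by
    refine mem_of_conn_of_closed (ends := ends) (ω := ω) ?_ rfl h
    rintro x rfl u hxu
    obtain ⟨_, e, he, hends⟩ := openGraph_adj.1 hxu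
    have : e = f := hpend e (by rw [hends]; exact Sym2.mem_mk_left _ _)
    rw [this, hf] at he
    exact absurd he Bool.false_ne_true
  exact hv key

variable [DecidableEq E]

/-- On a pendant-root instance, the same-copy product of `TB14` equals the product without the
second copy's `Q`. -/
lemma sameBO_eq_of_pendant (ends : E → Sym2 V) (a₁ a₂ b o : V) (f : E)
    (hpend : ∀ e, a₁ ∈ ends e → e = f) (ha : a₂ ≠ a₁) (hb : b ≠ a₁) (F : Finset E)
    (hfF : f ∈ F) (y : Config E) :
    (sameBO ends a₁ a₂ b o y (flipOn F y) : R) =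
      iQ ends a₁ a₂ y * iL ends a₁ b y * iH ends a₂ o y := by
  unfold sameBO
  by_cases hy : y f = true
  · have hf' : flipOn F y f = false := by rw [flipOn_of_mem F y hfF, hy]; rfl
    have hQ : (iQ ends a₁ a₂ (flipOn F y) : R) = 1 := by
      unfold iQ
      rw [Set.indicator_of_mem]
      · rfl
      · simp only [mem_avoidAll, Finset.mem_singleton, forall_eq]
        intro hc
        exact not_conn_of_pendant_closed ends a₁ f hpend hf' ha (conn_symm hc)
    rw [hQ, mul_one]
  · have hf' : y f = false := by simpa using hy
    have hL : (iL ends a₁ b y : R) = 0 := by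
      unfold iL
      rw [Set.indicator_of_notMem]
      rw [mem_connEvent]
      exact not_conn_of_pendant_closed ends a₁ f hpend hf' hb
    rw [hL]; simp

/-- On a pendant-root instance, the cross-copy product of `TB14` (with the copies exchanged: `A`
on the first copy, `Q ∩ B` on the second) equals the product without the second copy's `Q`. -/
lemma crossSw_eq_of_pendant (ends : E → Sym2 V) (a₁ a₂ b o : V) (f : E)
    (hpend : ∀ e, a₁ ∈ ends e → e = f) (ha : a₂ ≠ a₁) (hb : b ≠ a₁) (F : Finset E)
    (hfF : f ∈ F) (y : Config E) :
    (crossBO ends a₁ a₂ b o (flipOn F y) y : R) =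
      iQ ends a₁ a₂ y * iL ends a₁ b y * iH ends a₂ o (flipOn F y) := by
  unfold crossBO
  by_cases hy : y f = true
  · have hf' : flipOn F y f = false := by rw [flipOn_of_mem F y hfF, hy]; rfl
    have hQ : (iQ ends a₁ a₂ (flipOn F y) : R) = 1 := by
      unfold iQ
      rw [Set.indicator_of_mem]
      · rfl
      · simp only [mem_avoidAll, Finset.mem_singleton, forall_eq]
        intro hc
        exact not_conn_of_pendant_closed ends a₁ f hpend hf' ha (conn_symm hc)
    rw [hQ]; ring
  · have hf' : y f = false := by simpa using hy
    have hL : (iL ends a₁ b y : R) = 0 := by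
      unfold iL
      rw [Set.indicator_of_notMem]
      rw [mem_connEvent]
      exact not_conn_of_pendant_closed ends a₁ f hpend hf' hb
    rw [hL]; simp

variable [Fintype E] [LinearOrder R] [IsStrictOrderedRing R]

/-- **Typed BHK 1.4 on pendant-root instances** (THEOREM, unconditional): if `a₁` has exactly one
incident edge `f`, `f` is free, `b ≠ a₁` and `a₂ ≠ a₁`, then the `TB14` inequality holds at the
profile `(F, z)`: `N(Q ∩ A ∩ B, Q) ≤ N(Q ∩ B, Q ∩ A)`. -/
theorem tb14_of_pendant_root (ends : E → Sym2 V) (a₁ a₂ b o : V) (f : E)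
    (hpend : ∀ e, a₁ ∈ ends e → e = f) (ha : a₂ ≠ a₁) (hb : b ≠ a₁) (F : Finset E)
    (hfF : f ∈ F) (z : Config E) :
    pairCount F z (sameBO ends a₁ a₂ b o : Config E → Config E → R) ≤
      pairCount F z (crossBO ends a₁ a₂ b o) := by
  have h1 : pairCount F z (sameBO ends a₁ a₂ b o : Config E → Config E → R) =
      pairCount F z (fun y _ => iQ ends a₁ a₂ y * iL ends a₁ b y * iH ends a₂ o y) := by
    unfold pairCount
    refine Finset.sum_congr rfl fun y _ => ?_
    by_cases hadm : ∀ e, e ∉ F → y e = z e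
    · rw [if_pos hadm, if_pos hadm]
      exact sameBO_eq_of_pendant ends a₁ a₂ b o f hpend ha hb F hfF y
    · rw [if_neg hadm, if_neg hadm]
  have h2 : pairCount F z (crossBO ends a₁ a₂ b o : Config E → Config E → R) =
      pairCount F z (fun y w => iQ ends a₁ a₂ y * iL ends a₁ b y * iH ends a₂ o w) := by
    rw [pairCount_swap]
    unfold pairCount
    refine Finset.sum_congr rfl fun y _ => ?_
    by_cases hadm : ∀ e, e ∉ F → y e = z e
    · rw [if_pos hadm, if_pos hadm]
      exact crossSw_eq_of_pendant ends a₁ a₂ b o f hpend ha hb F hfF y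
    · rw [if_neg hadm, if_neg hadm]
  rw [h1, h2]
  exact pairCount_half ends a₁ a₂ b o F z

end Pendant

end TypedBHKHalf

end Summit.Ventures.PercRepro2
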